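import Summits.BirchSwinnertonDyer.Rank1Residual.Additive.ChiBranchLowerTransportPotMult
import Summits.BirchSwinnertonDyer.Rank1Residual.Additive.CycLeadingTermDvdIff
import HarnessLib

/-!
# N10 on the (M) locus, rank `0`: the END STATE at the BRANCH level — what remains of X4♯ / X3♯ is
# EXACTLY the Skinner–Urban direction on the `ω^{(p−1)/2}`-component of the `p`-multiplicative twist
# `E♭` at `T = 0` (cell `b2b-bsdres`, team n1011, seat p07, row T-N10-low; sequel of
# `ChiBranchLowerTransportPotMult.lean` and of n1011-p18's `CycLeadingTermDvdIff.lean`)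

HONEST FRAMING (cell `b2b-bsdres`, run/shared/lean/b2b/bsd-rank1-residual/, verbatim in every
file): the goal of the cell is to DELETE the COMBINATION-SHAPED residual classes of the
Birch–Swinnerton-Dyer formula for ALL analytic-rank `≤ 1` elliptic curves over `ℚ` — "full BSD
formula for every rank `≤ 1` curve in class `C`" assembled STRICTLY from published theorems — so
that the rank-`≤ 1` remainder becomes exactly the CONSTRUCTION-SHAPED classes, which are TYPED
(missing-input `Prop`s), NOT attempted. This is not "finishing BSD". Team n1011 (RESIDUAL-MAP §I
N10 / N11): prove what is provable now; shrink each hard class to its core with data; no claim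
beyond stated classes. Research route on the CONSTRUCTION-SHAPED item N10 (and the (M)@3 share of
N11's LOWER clause); both stay CONSTRUCTION; nothing is booked; no label moves. Theorems only
(compositions; no definition, no new named fact).

## What this file proves

n1011-p18's end state (`ClassX4M.x4MissingInputAt_iff_cycLowerLeadingTermAt_rankZero_of_surj`,
`ClassX3M.x3MissingInputAt_iff_cycLowerLeadingTermAt_rankZero`): on X4(M) ∧ surj(p) ∧ `r_an = 0`
resp. X3♯(M) ∧ `r_an = 0`, EVERY odd `p`, what remains of X4♯ / X3♯ is EXACTLY the team's typed
cyclotomic lower input `CycLowerLeadingTermAt W p` (Delbourgo's Main Conjecture (M), Skinner–Urban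
direction, at `T = 0`), granted the published upper chain (additive-p1: Delbourgo 1998 Prop. 4
`hDel`, `hmodD`, Wuthrich Lemma 20 `hL20` / Thm. 16 `hW16`, Kato on the `ω^{(p−1)/2}`-component
`hKato`), the exact Prop. 4 on (M) `hDelX`, GZK and modularity. Composing with this seat's
`ClassX4M/ClassX3M.cycLowerLeadingTermAt_iff_chiBranchLower[Odd]` (Birch + Pal; `hPal` on the even
branch):

* `ClassX4M.x4MissingInputAt_iff_chiBranchLower_rankZero_of_surj` (`p ≡ 1 (mod 4)`) and
  `ClassX4M.x4MissingInputAt_iff_chiBranchLowerOdd_rankZero_of_surj` (`p ≡ 3 (mod 4)`, `p = 3`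
  included): **`Typed.X4.MissingInputAt W p ↔ ChiBranchLowerLeadingTerm[Odd]At W p`** — what remains of
  X4♯ on X4(M) ∧ surj ∧ `r_an = 0` is EXACTLY the Skinner–Urban direction of the Iwasawa main
  conjecture of the `p`-MULTIPLICATIVE curve `E♭ = E ⊗ χ_{p*}` on the `ω^{(p−1)/2}`-COMPONENT over
  `ℚ(μ_{p^∞})`, at `T = 0`, transported to `E` by [C];
* `ClassX3M.x3MissingInputAt_iff_chiBranchLower[Odd]_rankZero`: the same for X3♯(M) (no image
  hypothesis);
* `ClassX4M.bsdp_rankZero_of_surj_of_chiBranchLower[Odd]`, `ClassX3M.bsdp_rankZero_of_chiBranchLower[Odd]`: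
  `BSD(E,p)` on these rows from the branch input (p18's `…bsdp_rankZero_…_of_cycLowerLeadingTerm`).

What is NOT claimed: the branch input is OPEN on every pair — Skinner–Urban 2014 Thm. 3.6.4 and
Skinner 2016 (multiplicative) give this direction on the `ω^0`-component only; Greenberg–Vatsal-type
transfer to a non-trivial branch is the X3 route of T-c2x3 (n1011-p12, `X3Branch*`); Burungale–
Skinner–Tian–Wan (arXiv:2409.01350) announce `p ∤ 6N_g`, which excludes a multiplicative `p`. Labels
UNCHANGED; nothing booked.

References: Delbourgo 1998 [Delbourgo1998] §2.2 Lemma (ii), Prop. 4, Main Conjecture p. 151;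
Wuthrich 2014 [Wuthrich2014] Lemma 20, Cor. 19, Thm. 16; Kato 2004 [Kato2004Asterisque] Thm. 17.4 (3);
Pal 2012 [Pal2012] Thm. 3.2; Skinner–Urban 2014 [SkinnerUrban2014] Thm. 3.6.4 and Remarks (i) p. 43.
-/

noncomputable section

open scoped Classical MatrixGroups ModularForm NumberField

open CongruenceSubgroup WeierstrassCurve NumberField Literature.NumberTheory.EllipticCurves
  Literature.NumberTheory.EllipticCurves.ModularForms
  Literature.NumberTheory.EllipticCurves.Rank1Residual
  Literature.NumberTheory.EllipticCurves.Rank1Residual.Typed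
  IsDedekindDomain Rat.HeightOneSpectrum

namespace Summit.BirchSwinnertonDyer.Rank1Residual.AdditivePotMult

open Additive

variable {W : WeierstrassCurve ℚ} [W.IsElliptic] [W.IsGloballyMinimal] {p : ℕ} [hp : Fact p.Prime]

/-! ### §1 X4(M) ∧ surj ∧ `r_an = 0`: what remains is EXACTLY the branch input -/

/-- **X4(M) ∧ surj(p) ∧ `r_an = 0`, `p ≡ 1 (mod 4)`: `Typed.X4.MissingInputAt W p ↔ ChiBranchLowerLeadingTermAt W p`.**
What remains of X4♯ on these rows is EXACTLY the Skinner–Urban direction on the `ω^{(p−1)/2}`-component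
of the `p`-multiplicative twist `E♭` at `T = 0` (granted `hDel hDelX hGZK hmod hmodD hL20 hKato hPal`).
[cite: Delbourgo1998, Prop. 4 (p. 144), §2.2 Lemma (ii) (p. 139), Main Conjecture (p. 151)]
[cite: Wuthrich2014, Lemma 20 (p. 399), Cor. 19 (p. 398)] [cite: Pal2012, Thm. 3.2] -/
theorem ClassX4M.x4MissingInputAt_iff_chiBranchLower_rankZero_of_surj
    (hDel : Delbourgo1998.prop4_rankZero_pow_dvd_constantCoeff)
    (hDelX : Delbourgo1998.prop4_rankZero_constantCoeff_eq_unit_mul_of_potMult)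
    (hPal : Pal2012.thm32_sqrt_mul_realPeriodRat_twist_eq_of_prime_one_mod_four)
    (hGZK : rank_eq_analyticRank_of_analyticRank_le_one) (hmod : hasEntireLFunction_rat)
    (hmodD : nonempty_modularParametrizationData)
    (hL20 : Wuthrich2014.lemma20_surjective_threeAdic_of_semistable)
    (hKato : Wuthrich2014.kato_halfEigenCharIdeal_dvd_cyclotomicPrime_of_surjective)
    (hX : ClassX4M W p) (hp4 : p % 4 = 1) (hr : W.analyticRank = 0) (hsurj : Surj W p) :
    X4.MissingInputAt W p ↔ ChiBranchLowerLeadingTermAt W p :=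
  (ClassX4M.x4MissingInputAt_iff_cycLowerLeadingTermAt_rankZero_of_surj hDel hDelX hGZK hmod hmodD
      hL20 hKato hX hr hsurj).trans
    (ClassX4M.cycLowerLeadingTermAt_iff_chiBranchLower hPal hmod hmodD hX hp4)

/-- **X4(M) ∧ surj(p) ∧ `r_an = 0`, `p ≡ 3 (mod 4)` (`p = 3` included):
`Typed.X4.MissingInputAt W p ↔ ChiBranchLowerLeadingTermOddAt W p`** (Pal for `d < 0` proved). At
`p = 3` this is the (M)@3 share of N11's class-level LOWER clause, stated on the branch.
[cite: Delbourgo1998, Prop. 4 (p. 144), §2.2 Lemma (ii) (p. 139), Main Conjecture (p. 151)]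
[cite: Wuthrich2014, Lemma 20 (p. 399), Cor. 19 (p. 398)] [cite: Pal2012, Thm. 3.2] -/
theorem ClassX4M.x4MissingInputAt_iff_chiBranchLowerOdd_rankZero_of_surj
    (hDel : Delbourgo1998.prop4_rankZero_pow_dvd_constantCoeff)
    (hDelX : Delbourgo1998.prop4_rankZero_constantCoeff_eq_unit_mul_of_potMult)
    (hGZK : rank_eq_analyticRank_of_analyticRank_le_one) (hmod : hasEntireLFunction_rat)
    (hmodD : nonempty_modularParametrizationData)
    (hL20 : Wuthrich2014.lemma20_surjective_threeAdic_of_semistable)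
    (hKato : Wuthrich2014.kato_halfEigenCharIdeal_dvd_cyclotomicPrime_of_surjective)
    (hX : ClassX4M W p) (hp4 : p % 4 = 3) (hr : W.analyticRank = 0) (hsurj : Surj W p) :
    X4.MissingInputAt W p ↔ ChiBranchLowerLeadingTermOddAt W p :=
  (ClassX4M.x4MissingInputAt_iff_cycLowerLeadingTermAt_rankZero_of_surj hDel hDelX hGZK hmod hmodD
      hL20 hKato hX hr hsurj).trans
    (ClassX4M.cycLowerLeadingTermAt_iff_chiBranchLowerOdd hmod hmodD hX hp4)

/-- **X4(M) ∧ surj(p) ∧ `r_an = 0`, `p ≡ 1 (mod 4)`: `BSD(E,p)` from the branch input** (through the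
cyclotomic input and p18's `ClassX4M.bsdp_rankZero_of_surj_of_cycLowerLeadingTerm`).
[cite: Delbourgo1998, Prop. 4 (p. 144), §2.2 Lemma (ii) (p. 139)] [cite: Pal2012, Thm. 3.2] -/
theorem ClassX4M.bsdp_rankZero_of_surj_of_chiBranchLower
    (hDel : Delbourgo1998.prop4_rankZero_pow_dvd_constantCoeff)
    (hDelX : Delbourgo1998.prop4_rankZero_constantCoeff_eq_unit_mul_of_potMult)
    (hPal : Pal2012.thm32_sqrt_mul_realPeriodRat_twist_eq_of_prime_one_mod_four)
    (hGZK : rank_eq_analyticRank_of_analyticRank_le_one) (hmod : hasEntireLFunction_rat)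
    (hmodD : nonempty_modularParametrizationData)
    (hL20 : Wuthrich2014.lemma20_surjective_threeAdic_of_semistable)
    (hKato : Wuthrich2014.kato_halfEigenCharIdeal_dvd_cyclotomicPrime_of_surjective)
    (hX : ClassX4M W p) (hp4 : p % 4 = 1) (hr : W.analyticRank = 0) (hsurj : Surj W p)
    (hLow : ChiBranchLowerLeadingTermAt W p) : BSDp W p :=
  bsdp_of_missingPPartAt W p hGZK (by rw [hr]; exact zero_le_one)
    ((ClassX4M.x4MissingInputAt_iff_chiBranchLower_rankZero_of_surj hDel hDelX hPal hGZK hmod hmodD hL20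
      hKato hX hp4 hr hsurj).mpr hLow)

/-- **X4(M) ∧ surj(p) ∧ `r_an = 0`, `p ≡ 3 (mod 4)`: `BSD(E,p)` from the odd branch input.**
[cite: Delbourgo1998, Prop. 4 (p. 144), §2.2 Lemma (ii) (p. 139)] [cite: Pal2012, Thm. 3.2] -/
theorem ClassX4M.bsdp_rankZero_of_surj_of_chiBranchLowerOdd
    (hDel : Delbourgo1998.prop4_rankZero_pow_dvd_constantCoeff)
    (hDelX : Delbourgo1998.prop4_rankZero_constantCoeff_eq_unit_mul_of_potMult)
    (hGZK : rank_eq_analyticRank_of_analyticRank_le_one) (hmod : hasEntireLFunction_rat)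
    (hmodD : nonempty_modularParametrizationData)
    (hL20 : Wuthrich2014.lemma20_surjective_threeAdic_of_semistable)
    (hKato : Wuthrich2014.kato_halfEigenCharIdeal_dvd_cyclotomicPrime_of_surjective)
    (hX : ClassX4M W p) (hp4 : p % 4 = 3) (hr : W.analyticRank = 0) (hsurj : Surj W p)
    (hLow : ChiBranchLowerLeadingTermOddAt W p) : BSDp W p :=
  bsdp_of_missingPPartAt W p hGZK (by rw [hr]; exact zero_le_one)
    ((ClassX4M.x4MissingInputAt_iff_chiBranchLowerOdd_rankZero_of_surj hDel hDelX hGZK hmod hmodD hL20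
      hKato hX hp4 hr hsurj).mpr hLow)

/-! ### §2 X3♯(M) ∧ `r_an = 0`: what remains is EXACTLY the branch input -/

/-- **X3♯(M) ∧ `r_an = 0`, `p ≡ 1 (mod 4)`: `Typed.X3.MissingInputAt W p ↔ ChiBranchLowerLeadingTermAt W p`**
(no image hypothesis; the upper half is additive-p1's Wuthrich Thm. 16 chain `hW16`).
[cite: Delbourgo1998, Prop. 4 (p. 144), §2.2 Lemma (ii) (p. 139), Main Conjecture (p. 151)]
[cite: Wuthrich2014, Thm. 16 (p. 397)] [cite: Pal2012, Thm. 3.2] -/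
theorem ClassX3M.x3MissingInputAt_iff_chiBranchLower_rankZero
    (hDel : Delbourgo1998.prop4_rankZero_pow_dvd_constantCoeff)
    (hDelX : Delbourgo1998.prop4_rankZero_constantCoeff_eq_unit_mul_of_potMult)
    (hPal : Pal2012.thm32_sqrt_mul_realPeriodRat_twist_eq_of_prime_one_mod_four)
    (hGZK : rank_eq_analyticRank_of_analyticRank_le_one) (hmod : hasEntireLFunction_rat)
    (hmodD : nonempty_modularParametrizationData)
    (hW16 : Wuthrich2014.thm16_halfEigenCharIdeal_dvd_cyclotomicPrime)
    (hX : ClassX3M W p) (hp4 : p % 4 = 1) (hr : W.analyticRank = 0) :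
    X3.MissingInputAt W p ↔ ChiBranchLowerLeadingTermAt W p :=
  (ClassX3M.x3MissingInputAt_iff_cycLowerLeadingTermAt_rankZero hDel hDelX hGZK hmod hmodD hW16 hX
      hr).trans
    (ClassX3M.cycLowerLeadingTermAt_iff_chiBranchLower hPal hmod hmodD hX hp4)

/-- **X3♯(M) ∧ `r_an = 0`, `p ≡ 3 (mod 4)`: `Typed.X3.MissingInputAt W p ↔ ChiBranchLowerLeadingTermOddAt W p`.**
[cite: Delbourgo1998, Prop. 4 (p. 144), §2.2 Lemma (ii) (p. 139), Main Conjecture (p. 151)]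
[cite: Wuthrich2014, Thm. 16 (p. 397)] [cite: Pal2012, Thm. 3.2] -/
theorem ClassX3M.x3MissingInputAt_iff_chiBranchLowerOdd_rankZero
    (hDel : Delbourgo1998.prop4_rankZero_pow_dvd_constantCoeff)
    (hDelX : Delbourgo1998.prop4_rankZero_constantCoeff_eq_unit_mul_of_potMult)
    (hGZK : rank_eq_analyticRank_of_analyticRank_le_one) (hmod : hasEntireLFunction_rat)
    (hmodD : nonempty_modularParametrizationData)
    (hW16 : Wuthrich2014.thm16_halfEigenCharIdeal_dvd_cyclotomicPrime)
    (hX : ClassX3M W p) (hp4 : p % 4 = 3) (hr : W.analyticRank = 0) :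
    X3.MissingInputAt W p ↔ ChiBranchLowerLeadingTermOddAt W p :=
  (ClassX3M.x3MissingInputAt_iff_cycLowerLeadingTermAt_rankZero hDel hDelX hGZK hmod hmodD hW16 hX
      hr).trans
    (ClassX3M.cycLowerLeadingTermAt_iff_chiBranchLowerOdd hmod hmodD hX hp4)

/-- **X3♯(M) ∧ `r_an = 0`, `p ≡ 1 (mod 4)`: `BSD(E,p)` from the branch input.**
[cite: Delbourgo1998, Prop. 4 (p. 144), §2.2 Lemma (ii) (p. 139)] [cite: Wuthrich2014, Thm. 16 (p. 397)] -/
theorem ClassX3M.bsdp_rankZero_of_chiBranchLower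
    (hDel : Delbourgo1998.prop4_rankZero_pow_dvd_constantCoeff)
    (hDelX : Delbourgo1998.prop4_rankZero_constantCoeff_eq_unit_mul_of_potMult)
    (hPal : Pal2012.thm32_sqrt_mul_realPeriodRat_twist_eq_of_prime_one_mod_four)
    (hGZK : rank_eq_analyticRank_of_analyticRank_le_one) (hmod : hasEntireLFunction_rat)
    (hmodD : nonempty_modularParametrizationData)
    (hW16 : Wuthrich2014.thm16_halfEigenCharIdeal_dvd_cyclotomicPrime)
    (hX : ClassX3M W p) (hp4 : p % 4 = 1) (hr : W.analyticRank = 0)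
    (hLow : ChiBranchLowerLeadingTermAt W p) : BSDp W p :=
  bsdp_of_missingPPartAt W p hGZK (by rw [hr]; exact zero_le_one)
    ((ClassX3M.x3MissingInputAt_iff_chiBranchLower_rankZero hDel hDelX hPal hGZK hmod hmodD hW16 hX hp4
      hr).mpr hLow)

/-- **X3♯(M) ∧ `r_an = 0`, `p ≡ 3 (mod 4)`: `BSD(E,p)` from the odd branch input.**
[cite: Delbourgo1998, Prop. 4 (p. 144), §2.2 Lemma (ii) (p. 139)] [cite: Wuthrich2014, Thm. 16 (p. 397)] -/
theorem ClassX3M.bsdp_rankZero_of_chiBranchLowerOdd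
    (hDel : Delbourgo1998.prop4_rankZero_pow_dvd_constantCoeff)
    (hDelX : Delbourgo1998.prop4_rankZero_constantCoeff_eq_unit_mul_of_potMult)
    (hGZK : rank_eq_analyticRank_of_analyticRank_le_one) (hmod : hasEntireLFunction_rat)
    (hmodD : nonempty_modularParametrizationData)
    (hW16 : Wuthrich2014.thm16_halfEigenCharIdeal_dvd_cyclotomicPrime)
    (hX : ClassX3M W p) (hp4 : p % 4 = 3) (hr : W.analyticRank = 0)
    (hLow : ChiBranchLowerLeadingTermOddAt W p) : BSDp W p :=
  bsdp_of_missingPPartAt W p hGZK (by rw [hr]; exact zero_le_one)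
    ((ClassX3M.x3MissingInputAt_iff_chiBranchLowerOdd_rankZero hDel hDelX hGZK hmod hmodD hW16 hX hp4
      hr).mpr hLow)

end Summit.BirchSwinnertonDyer.Rank1Residual.AdditivePotMult

end
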